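import Summits.BirchSwinnertonDyer.BirchSwinnertonDyer.Theses.QuadraticBranchSignedControl
import Summits.BirchSwinnertonDyer.Rank1Residual.Additive.QuadraticTowerRestrict
import Summits.BirchSwinnertonDyer.Rank1Residual.Additive.SignedTwistOddBranchReadings
import Mathlib.FieldTheory.IntermediateField.Adjoin.Basic
import HarnessLib

/-!
# Route `QuadraticBranchSignedControl` (rung K8, cell `bsd-potss`), crux `EtaTransportSigned`
# (item stmt-BirchSwinnertonDyer-19115): the last frame (A) of the plus stub REDUCED to the pure
# Selmer comparison `Sel⁺(V_F/F_∞) ≃ Sel⁺(V/Fℚ_∞)` for EVERY quadratic field `F = ℚ(√p*)` — the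
# admissible quadratic model `(F, θ_F, V', κF, γF)` is PRODUCED here ((i-a) + (i-b))

WHAT. Frame (A) of `…EtaTransportDecompositionOfFrames.lean` / `…DecompositionOfFrameA.lean` asks,
for the stub's binders, for SOME (C1_η)-admissible quadratic model — a number field `F` of degree
`2` with `θ_F ∈ F ∖ ℚ`, `θ_F² = p*`, `Gal(ℚ̄/F)` normal, the `F`-model `V' = V_F`, a cyclotomic
`ℤ_p`-extension `κF` of `F` with a topological generator `γF` matching the cyclotomic variable and
`γ⁻¹·γF|_{ℚ̄} ∈ ker κ` — TOGETHER WITH a `Γ`-compatible additive isomorphism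
`Ψ_A : Sel⁺(V'/F_∞^{κF})` (Kobayashi Def. 1.1 inside `Γ_F`) `≃ Sel⁺(V/Fℚ_∞)` (cc-typer-6's tower
object inside `Γ_ℚ` at `ℚ_[p]`). THIS FILE produces the model: `F := ℚ(θ₀) ⊂ K₀` for a square root
`θ₀` of `p*` in `K₀ = ℚ(μ_p)` (Gauss, `exists_sq_eq_pStar`) as Mathlib's `IntermediateField.adjoin`,
`[F : ℚ] = deg minpoly(θ₀) = 2`, `V' := V.baseChange F`, `κF := κ|_{Γ_F}` (ctrl's (i-b)
`BaseChange.restrictGal`, cyclotomic), `γF` from `exists_generator_restrictGal`, the `ζ`-clause from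
`exists_zeta_of_isCyclotomicVariable` — and so reduces (A) to the displayed, model-free comparison
`hSel`: for EVERY quadratic `F ∋ θ_F` (`θ_F² = p*`), with `κ` onto on `Gal(ℚ̄/F)` and any generator
`γF` of `κ|_{Γ_F}`, an additive isomorphism
`Kobayashi2003.signedSelmerInfty (V.baseChange F) (restrictGal F κ hκ₀) 1 ≃+ towerSignedSelmerInfty V κ F ℚ_[p] 1`
intertwining `conj_{γF}` with `conj_{γF|_{ℚ̄}}` — ctrl memo v7 §2j (i-c) verbatim («THE LONG POLE»;
its `H¹`-level half is ctrl's `BaseChange.subgroupH1Iso`, p405844; the local conditions — classical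
at all places of `F`, plus at the ramified place — are what remains).

HONEST FRAMING (cell `bsd-potss`, run/shared/lean/pub/bsd-potss/; FULL-BSD rank ≤ 1 programme):
TOOL THEOREM ONLY — no definition, no named Literature fact, no `sorry`, axioms standard.
CONDITIONAL on the displayed frame `hSel` (WANTED; = (i-c)); closes nothing; nothing is booked;
`BSD(W, p)` is claimed for no pair. Seat `bsd-potss-k8q-c3` (prover), g0.

References: [Kobayashi2003] Def. 1.1 (p. 2), Def. 2.1 (p. 5), §3 p. 5 (`γ ↔ 1 + X`), §4 p. 8;
[Washington1997] §13.1 (the cyclotomic `ℤ_p`-extension of a number field);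
[SerreGaloisCohomology1997] II.§1.1.
-/

set_option autoImplicit false
set_option linter.dupNamespace false

noncomputable section

open scoped Classical IntermediateField

open Field WeierstrassCurve Polynomial
open Literature.NumberTheory.EllipticCurves
open Literature.NumberTheory.GaloisRepresentations
open Summit.BirchSwinnertonDyer.Rank1Residual.Additive
open Summit.BirchSwinnertonDyer.Rank1Residual.Additive.SignedTwist
open Summit.BirchSwinnertonDyer.Rank1Residual.AdditivePotMult

namespace Summit.BirchSwinnertonDyer.BirchSwinnertonDyer.Theorems

/-- For `θ ∈ K₀ ∖ ℚ` with `θ² = c ∈ ℚ`: `[ℚ(θ) : ℚ] = 2` (`= deg minpoly_ℚ(θ)`; `≥ 2` as `θ ∉ ℚ`,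
`≤ 2` as `θ` is a root of `X² − c`). [folklore] -/
theorem finrank_adjoin_simple_eq_two_of_sq_eq (K₀ : Type) [Field K₀] [NumberField K₀] {θ : K₀}
    {c : ℚ} (hθ : θ ∉ Set.range (algebraMap ℚ K₀)) (hc : θ ^ 2 = algebraMap ℚ K₀ c) :
    Module.finrank ℚ ℚ⟮θ⟯ = 2 := by
  have hint : IsIntegral ℚ θ := Algebra.IsIntegral.isIntegral θ
  rw [IntermediateField.adjoin.finrank hint]
  apply le_antisymm
  · have hP : (X ^ 2 - C c : ℚ[X]) ≠ 0 := by
      apply_fun (fun q => q.natDegree)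
      rw [natDegree_X_pow_sub_C, natDegree_zero]
      decide
    have hroot : aeval θ (X ^ 2 - C c : ℚ[X]) = 0 := by
      rw [map_sub, map_pow, aeval_X, aeval_C, hc, sub_self]
    have h := minpoly.degree_le_of_ne_zero ℚ θ hP hroot
    rw [degree_X_pow_sub_C (by decide) c] at h
    exact natDegree_le_iff_degree_le.mpr h
  · rw [minpoly.two_le_natDegree_iff hint]
    rintro ⟨q, hq⟩
    exact hθ ⟨q, hq⟩

/-- **Frame (A) from the model-free Selmer comparison `hSel`** (the admissible quadratic model is
produced: `F = ℚ(√p*) ⊂ ℚ(μ_p)`, `V' = V_F`, `κF = κ|_{Γ_F}`, `γF` a generator with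
`γ⁻¹·γF| ∈ ker κ`). The conclusion is the frame `hA` of `etaDecomposition_of_frames` /
`etaDecomposition_of_frameA` VERBATIM. CONDITIONAL on `hSel` (= ctrl's (i-c)).
[cite: Kobayashi2003, Def. 1.1 (p. 2), Def. 2.1 (p. 5), §3 p. 5] [cite: Washington1997, §13.1] -/
theorem frameA_of_selmerComparison
    (hSel : ∀ (p : ℕ) [Fact p.Prime], 5 ≤ p →
      ∀ (V : WeierstrassCurve ℚ) [V.IsElliptic] [V.IsGloballyMinimal],
        V.HasGoodReductionAtPrime p → V.frobeniusTrace p = 0 →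
      ∀ (κ : ZpExtension ℚ p), κ.IsCyclotomic →
      ∀ (F : Type) [Field F] [NumberField F] [(galRange (K := ℚ) F).Normal] (θF : F),
        Module.finrank ℚ F = 2 → θF ∉ Set.range (algebraMap ℚ F) →
        θF ^ 2 = algebraMap ℚ F ((-1) ^ (p / 2) * p) →
      ∀ (hκ₀ : ∀ x, ∃ g ∈ galRange (K := ℚ) F, κ g = x) (γF : absoluteGaloisGroup F),
        (BaseChange.restrictGal F κ hκ₀).IsTopGenerator γF →
      ∃ ΨA : Kobayashi2003.signedSelmerInfty (V.baseChange F) (BaseChange.restrictGal F κ hκ₀) 1 ≃+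
          towerSignedSelmerInfty V κ F ℚ_[p] 1,
        ∀ s : Kobayashi2003.signedSelmerInfty (V.baseChange F) (BaseChange.restrictGal F κ hκ₀) 1,
          ((ΨA ⟨(V.baseChange F).conjH1 p (BaseChange.restrictGal F κ hκ₀).kerSubgroup γF s,
              Kobayashi2003.conjH1_mem_signedSelmerInfty (V.baseChange F)
                (BaseChange.restrictGal F κ hκ₀) 1 γF s.2⟩ :
              towerSignedSelmerInfty V κ F ℚ_[p] 1) : V.subgroupH1 p (towerTopSubgroup κ F)) =
            V.conjH1 p (towerTopSubgroup κ F) (resGal (K := ℚ) F γF) (ΨA s)) :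
    ∀ (p : ℕ) [Fact p.Prime], 5 ≤ p →
      ∀ (K₀ : Type) [Field K₀] [NumberField K₀] [IsCyclotomicExtension {p} ℚ K₀]
        [(galRange (K := ℚ) K₀).Normal] (ηq : absoluteGaloisGroup ℚ →* ℤˣ),
        (∀ σ ∈ galRange (K := ℚ) K₀, ηq σ = 1) → ηq ≠ 1 →
      ∀ (V : WeierstrassCurve ℚ) [V.IsElliptic] [V.IsGloballyMinimal],
        V.HasGoodReductionAtPrime p → V.frobeniusTrace p = 0 →
      ∀ (κ : ZpExtension ℚ p) (γ : absoluteGaloisGroup ℚ),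
        κ.IsCyclotomic → κ.IsTopGenerator γ → γ ∈ galRange (K := ℚ) K₀ →
        IsCyclotomicVariable p γ →
      ∃ (F : Type) (_ : Field F) (_ : NumberField F) (_ : (galRange (K := ℚ) F).Normal) (θF : F)
        (V' : WeierstrassCurve F) (_ : V'.IsElliptic) (κF : ZpExtension F p)
        (γF : absoluteGaloisGroup F)
        (ΨA : Kobayashi2003.signedSelmerInfty V' κF 1 ≃+ towerSignedSelmerInfty V κ F ℚ_[p] 1),
        Module.finrank ℚ F = 2 ∧ θF ∉ Set.range (algebraMap ℚ F) ∧
        θF ^ 2 = algebraMap ℚ F ((-1) ^ (p / 2) * p) ∧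
        (∃ C : VariableChange F, C • V.baseChange F = V') ∧
        κF.IsCyclotomic ∧ κF.IsTopGenerator γF ∧
        (∃ ζ : ℤ_[p]ˣ, IsOfFinOrder ζ ∧
          ((GaloisRep.cyclotomicCharacter F p γF * ζ : ℤ_[p]ˣ) : ℤ_[p]) =
            (cyclotomicGenerator p : ℤ_[p])) ∧
        γ⁻¹ * resGal (K := ℚ) F γF ∈ κ.kerSubgroup ∧
        ∀ s : Kobayashi2003.signedSelmerInfty V' κF 1,
          ((ΨA ⟨V'.conjH1 p κF.kerSubgroup γF s,
              Kobayashi2003.conjH1_mem_signedSelmerInfty V' κF 1 γF s.2⟩ :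
              towerSignedSelmerInfty V κ F ℚ_[p] 1) : V.subgroupH1 p (towerTopSubgroup κ F)) =
            V.conjH1 p (towerTopSubgroup κ F) (resGal (K := ℚ) F γF) (ΨA s) := by
  intro p _ hp5 K₀ _ _ _ _ ηq _ _ V _ _ hgood hap κ γ hκ hγ _ hγc
  have hpP : p.Prime := Fact.out
  have hp2 : p ≠ 2 := by omega
  -- a square root of `p*` in `K₀` (Gauss)
  obtain ⟨θ₀, hθ₀2⟩ := exists_sq_eq_pStar p K₀ hp2
  have hc₀ : θ₀ ^ 2 = algebraMap ℚ K₀ ((-1) ^ (p / 2) * p) := by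
    rw [hθ₀2, map_mul, map_pow, map_neg, map_one, map_natCast]
  have hθ₀ : θ₀ ∉ Set.range (algebraMap ℚ K₀) := by
    rintro ⟨q, hq⟩
    apply forall_sq_ne_pStar p q
    apply (algebraMap ℚ K₀).injective
    rw [map_pow, hq, hc₀]
  -- the quadratic field `F = ℚ(θ₀) ⊂ K₀`
  let F : Type := ℚ⟮θ₀⟯
  have h2 : Module.finrank ℚ F = 2 := finrank_adjoin_simple_eq_two_of_sq_eq K₀ hθ₀ hc₀
  haveI : IsGalois ℚ F := isGalois_of_finrank_eq_two F h2
  haveI hN : (galRange (K := ℚ) F).Normal := RelModel.normal_galRange (K := ℚ) F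
  let θF : F := ⟨θ₀, IntermediateField.mem_adjoin_simple_self ℚ θ₀⟩
  have hcF : θF ^ 2 = algebraMap ℚ F ((-1) ^ (p / 2) * p) := by
    apply Subtype.ext
    change θ₀ ^ 2 = ((algebraMap ℚ F ((-1) ^ (p / 2) * p) : F) : K₀)
    rw [hc₀]
    rfl
  have hθF : θF ∉ Set.range (algebraMap ℚ F) := by
    rintro ⟨q, hq⟩
    apply hθ₀ ⟨q, ?_⟩
    have h1 : ((algebraMap ℚ F q : F) : K₀) = algebraMap ℚ K₀ q := rfl
    exact h1.symm.trans (congrArg Subtype.val hq)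
  -- `κ` is onto on `Gal(ℚ̄/F)` (`p ∤ 2 = [F : ℚ]`), the restricted tower and its generator
  have hcop : p.Coprime (Module.finrank ℚ F) := by
    rw [h2]; exact (Nat.coprime_primes hpP Nat.prime_two).mpr hp2
  have hκ₀ : ∀ x, ∃ g ∈ galRange (K := ℚ) F, κ g = x :=
    kappa_surjOn_galRange_of_coprime_finrank κ F hcop
  obtain ⟨γF, hγF, hδ, -⟩ := BaseChange.exists_generator_restrictGal F κ hκ₀ hγ
  have hγFc : IsCyclotomicVariable p (resGal (K := ℚ) F γF) :=
    isCyclotomicVariable_of_inv_mul_mem_ker hκ hδ hγc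
  obtain ⟨ΨA, hΨA⟩ := hSel p hp5 V hgood hap κ hκ F θF h2 hθF hcF hκ₀ γF hγF
  exact ⟨F, inferInstance, inferInstance, hN, θF, V.baseChange F, inferInstance,
    BaseChange.restrictGal F κ hκ₀, γF, ΨA, h2, hθF, hcF, ⟨1, one_smul _ _⟩,
    BaseChange.isCyclotomic_restrictGal F κ hκ₀ hκ, hγF,
    BaseChange.exists_zeta_of_isCyclotomicVariable F hγFc, hδ, hΨA⟩

end Summit.BirchSwinnertonDyer.BirchSwinnertonDyer.Theorems

end
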